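import Summits.BirchSwinnertonDyer.BirchSwinnertonDyer.Theorems.ResidualThetaTransportAtTwoSignedMuSeedAtTwoPlusKroneckerBits
import HarnessLib

/-!
# Kronecker bits III — the Galois mirror of the half resolvent (T0a), the identification of the level-`0` constant with the
# reduced half resolvent (KB3 core), integrality from one good smoothing, and the rung-R0 bookkeeping
# (seed crux `SignedMuSeedAtTwoPlus` stmt-BirchSwinnertonDyer-21438; parent Kμ⁺ stmt-BirchSwinnertonDyer-20689, route
# ResidualThetaTransportAtTwo; line card `Cruxes/SignedMuSeedAtTwoPlus/Lines/kronecker-bits.md`, stubs KB2/KB3 and (T0a))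

Cell `bsd-wall`, width seat `bsd-wall-rtt-p4-w2` g16 (`--supports`, closes nothing).  THEOREMS ONLY; BSD is not proved by this.

Setting as in `…KroneckerBits.lean`: a finite abelian group `G` (informally `(𝒪_K/𝔣₀)ˣ`), `m` with `m * m = 1` (informally `−1`),
systems of representatives `Rset` modulo `⟨m⟩` (hypothesis kept verbatim), an odd orbit function `E` (informally `c ↦ E₁(cΩ/f₀; Ω𝒪_K)`),
an even character `χ` (informally `χ₀^e`) and an odd character `κ`; the HALF RESOLVENTS are
`Λ_e := Σ_{Rset} χ(c)⁻¹ κ(c) E(c)` and its mirror `Λ_{−e} := Σ_{Rset} χ(c) κ(c) E(c)`.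

* `map_inv_char_of_map_char_eq_inv` — a ring hom with `σ(χ c) = χ(c)⁻¹` has `σ(χ(c)⁻¹) = χ(c)`;
* `halfSum_reindex_weight` — `Σ_{Rset} w(c) E(t c) = u · Σ_{Rset} w(c) E(c)` for a twist weight `w(c) = u·w(tc)` with `w·E`
  invariant under `c ↦ m c` (representative-independence, from `…KroneckerBits.lean`);
* **`halfResolvent_mirror`** (T0a core) — for a ring endomorphism `σ` with `σ(E c) = E(t c)` (Galois acts on torsion values by a
  translation `t`), `σ ∘ χ = χ⁻¹` (informally `τ(ζ₃) = ζ₃²`) and `σ ∘ κ = κ` (`τ` fixes `ζ_{2^∞}`):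
  `σ(Λ_e) = χ(t)⁻¹ κ(t)⁻¹ · Λ_{−e}`; hence **`halfResolvent_mem_comap_iff`**: `Λ_e ∈ σ⁻¹Q ⟺ Λ_{−e} ∈ Q` for every ideal `Q`
  («the two twists are the two primes»);
* **`levelZero_constant_eq_red_halfResolvent`** (KB3 core) — if the reduced half-orbit functional obeys law (A)
  `red(Σ_{Rset} χ⁻¹ Gα) = κ_χ · red(a χ(α)κ(α)⁻¹ − N)` at ONE smoothing `α` whose factor `red(a χ(α)κ(α)⁻¹ − N)` is a unit of `R ⧸ P`,
  then `κ_χ = red(Λ_e)` (`red_halfFunctional_eq` = KB2 in `R ⧸ P`, + cancellation); `levelZero_constant_eq_zero_iff` — the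
  level-`0` bit: `κ_χ = 0 ⟺ Λ_e ∈ P`;
* `mem_subring_of_isUnit_mul_mem` / **`halfResolvent_mem_subring`** — integrality of `Λ_e` from ONE smoothing with integral
  functional and unit factor (the card's «choosing `α` with `η_e(α) ≠ 1` gives integrality of `Λ_e`»);
* `notMem_or_notMem_iff_not_dvd` / **`levelZero_live_iff_not_dvd`** — rung R0 under T0: with `(π) = Q ⊓ σ⁻¹Q`
  (informally `𝔔₁𝔔₂ = (1 − ζ_{2^k})`), «live at level `0` for some twist» `⟺ π ∤ Λ_e`.

[folklore]
-/

set_option autoImplicit false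
-- the Theorems namespace of this sub repeats the summit name by design (D-0017 nested layout)
set_option linter.dupNamespace false

open Finset

namespace Summit.BirchSwinnertonDyer.BirchSwinnertonDyer.Theorems.SignedMuAtTwo.KroneckerBits

/-! ## The Galois mirror (T0a) -/

section Mirror

variable {G R : Type*} [CommGroup G] [CommRing R] {m : G} {Rset : Finset G}

/-- A ring hom inverting the values of a character (`σ(χ c) = χ(c)⁻¹`) maps `χ(c)⁻¹` to `χ(c)`. [folklore] -/
theorem map_inv_char_of_map_char_eq_inv {R' : Type*} [CommRing R'] (σ : R →+* R') (χ : G →* Rˣ) (χ' : G →* R'ˣ)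
    (hσχ : ∀ c, σ (χ c : R) = (((χ' c)⁻¹ : R'ˣ) : R')) (c : G) :
    σ (((χ c)⁻¹ : Rˣ) : R) = (χ' c : R') := by
  have h : σ (((χ c)⁻¹ : Rˣ) : R) * (((χ' c)⁻¹ : R'ˣ) : R') = 1 := by
    rw [← hσχ c, ← map_mul, Units.inv_mul, map_one]
  exact Units.mul_inv_eq_one.mp h

/-- A ring hom fixing the values of a character fixes their inverses. [folklore] -/
theorem map_inv_char_of_map_char_eq {R' : Type*} [CommRing R'] (σ : R →+* R') (κ : G →* Rˣ) (κ' : G →* R'ˣ)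
    (hσκ : ∀ c, σ (κ c : R) = (κ' c : R')) (c : G) :
    σ (((κ c)⁻¹ : Rˣ) : R) = (((κ' c)⁻¹ : R'ˣ) : R') := by
  have h : σ (((κ c)⁻¹ : Rˣ) : R) * (κ' c : R') = 1 := by
    rw [← hσκ c, ← map_mul, Units.inv_mul, map_one]
  exact Units.eq_inv_of_mul_eq_one_right h

/-- **Half-orbit twisted re-indexing**: for a twist weight `w(c) = u·w(tc)` with `w·E` invariant under `c ↦ m c` and any system of
representatives modulo `⟨m⟩`, `Σ_{Rset} w(c) E(tc) = u · Σ_{Rset} w(c) E(c)` (representative-independence). [folklore] -/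
theorem halfSum_reindex_weight [DecidableEq G] (E w : G → R) (t : G) (u : R)
    (hw : ∀ c, w c = u * w (t * c)) (hinv : ∀ c, w (m * c) * E (m * c) = w c * E c) (hm : m * m = 1)
    (hR : ∀ c, (c ∈ Rset ∧ m * c ∉ Rset) ∨ (c ∉ Rset ∧ m * c ∈ Rset)) :
    ∑ c ∈ Rset, w c * E (t * c) = u * ∑ c ∈ Rset, w c * E c := by
  have h := halfResolvent_reindex_weight E w t u 1 0 hw hinv hm hR
  simpa only [one_mul, zero_mul, sub_zero, mul_one] using h

/-- The mirror weight `c ↦ χ(c) κ(c)` is a twist weight with `u = χ(t)⁻¹ κ(t)⁻¹`. [folklore] -/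
theorem chi_mul_kappa_weight (χ κ : G →* Rˣ) (t c : G) :
    (χ c : R) * (κ c : R) = ((((χ t)⁻¹ : Rˣ) : R) * (((κ t)⁻¹ : Rˣ) : R)) * ((χ (t * c) : R) * (κ (t * c) : R)) := by
  have h1 : (((χ t)⁻¹ : Rˣ) : R) * (χ t : R) = 1 := Units.inv_mul _
  have h2 : (((κ t)⁻¹ : Rˣ) : R) * (κ t : R) = 1 := Units.inv_mul _
  rw [map_mul, map_mul, Units.val_mul, Units.val_mul]
  linear_combination (-((χ c : R) * (κ c : R) * ((((κ t)⁻¹ : Rˣ) : R) * (κ t : R)))) * h1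
    + (-((χ c : R) * (κ c : R))) * h2

/-- For `E` odd, `χ` even, `κ` odd the mirror summand `χ(c) κ(c) E(c)` is invariant under `c ↦ m c`. [folklore] -/
theorem chi_mul_kappa_mul_invariant (E : G → R) (χ κ : G →* Rˣ) (hE : ∀ c, E (m * c) = -E c) (hχ : χ m = 1)
    (hκ : κ m = -1) (c : G) :
    (χ (m * c) : R) * (κ (m * c) : R) * E (m * c) = (χ c : R) * (κ c : R) * E c := by
  rw [map_mul, map_mul, hχ, hκ, one_mul, Units.val_mul, Units.val_neg, Units.val_one, hE]
  ring

/-- **The Galois mirror of the half resolvent (T0a core).**  Let `σ` be a ring endomorphism with `σ(E c) = E(t c)` for a fixed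
`t ∈ G`, `σ(χ c) = χ(c)⁻¹` and `σ(κ c) = κ c`.  Then for `E` odd, `χ` even, `κ` odd and any representatives `Rset` modulo `⟨m⟩`:
`σ(Σ_{Rset} χ(c)⁻¹ κ(c) E(c)) = χ(t)⁻¹ κ(t)⁻¹ · Σ_{Rset} χ(c) κ(c) E(c)` — informally `τ(Λ_e) = (root of unity)·Λ_{−e}`. [folklore] -/
theorem halfResolvent_mirror [DecidableEq G] (σ : R →+* R) (E : G → R) (χ κ : G →* Rˣ) (t : G)
    (hσE : ∀ c, σ (E c) = E (t * c)) (hσχ : ∀ c, σ (χ c : R) = (((χ c)⁻¹ : Rˣ) : R)) (hσκ : ∀ c, σ (κ c : R) = (κ c : R))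
    (hm : m * m = 1) (hE : ∀ c, E (m * c) = -E c) (hχ : χ m = 1) (hκ : κ m = -1)
    (hR : ∀ c, (c ∈ Rset ∧ m * c ∉ Rset) ∨ (c ∉ Rset ∧ m * c ∈ Rset)) :
    σ (∑ c ∈ Rset, (((χ c)⁻¹ : Rˣ) : R) * (κ c : R) * E c)
      = ((((χ t)⁻¹ : Rˣ) : R) * (((κ t)⁻¹ : Rˣ) : R)) * ∑ c ∈ Rset, (χ c : R) * (κ c : R) * E c := by
  rw [map_sum]
  have hterm : ∀ c, σ ((((χ c)⁻¹ : Rˣ) : R) * (κ c : R) * E c) = (χ c : R) * (κ c : R) * E (t * c) := by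
    intro c
    rw [map_mul, map_mul, map_inv_char_of_map_char_eq_inv σ χ χ hσχ, hσκ, hσE]
  simp only [hterm]
  exact halfSum_reindex_weight E (fun c => (χ c : R) * (κ c : R)) t _ (chi_mul_kappa_weight χ κ t)
    (chi_mul_kappa_mul_invariant E χ κ hE hχ hκ) hm hR

/-- **«The two twists are the two primes.»**  Under the hypotheses of `halfResolvent_mirror`, for every ideal `Q`:
`Λ_e ∈ σ⁻¹ Q ⟺ Λ_{−e} ∈ Q` (the mirror factor is a unit). [folklore] -/
theorem halfResolvent_mem_comap_iff [DecidableEq G] (σ : R →+* R) (E : G → R) (χ κ : G →* Rˣ) (t : G) (Q : Ideal R)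
    (hσE : ∀ c, σ (E c) = E (t * c)) (hσχ : ∀ c, σ (χ c : R) = (((χ c)⁻¹ : Rˣ) : R)) (hσκ : ∀ c, σ (κ c : R) = (κ c : R))
    (hm : m * m = 1) (hE : ∀ c, E (m * c) = -E c) (hχ : χ m = 1) (hκ : κ m = -1)
    (hR : ∀ c, (c ∈ Rset ∧ m * c ∉ Rset) ∨ (c ∉ Rset ∧ m * c ∈ Rset)) :
    (∑ c ∈ Rset, (((χ c)⁻¹ : Rˣ) : R) * (κ c : R) * E c) ∈ Q.comap σ
      ↔ (∑ c ∈ Rset, (χ c : R) * (κ c : R) * E c) ∈ Q := by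
  rw [Ideal.mem_comap, halfResolvent_mirror σ E χ κ t hσE hσχ hσκ hm hE hχ hκ hR, ← Units.val_mul]
  exact Ideal.unit_mul_mem_iff_mem Q ((χ t)⁻¹ * (κ t)⁻¹).isUnit

end Mirror

/-! ## KB3 core: the level-`0` constant is the reduced half resolvent -/

section Identification

variable {G R : Type*} [CommGroup G] [DecidableEq G] [CommRing R] {m : G} {Rset : Finset G}

/-- **KB2 in the residue ring** (universe-polymorphic form of `levelZeroKroneckerLaw`): for `E` odd, `χ` even, `κ` odd with
`κ ≡ 1 (mod P)`, `Gα = a•E(α·) − N•E` and any representatives, `red(Σ_{Rset} χ⁻¹ Gα) = red(a χ(α) κ(α)⁻¹ − N) · red(Λ_e)` in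
`R ⧸ P`, `Λ_e = Σ_{Rset} χ⁻¹ κ E`. [folklore] -/
theorem red_halfFunctional_eq (P : Ideal R) (E Gα : G → R) (χ κ : G →* Rˣ) (α : G) (a N : R)
    (hm : m * m = 1) (hE : ∀ c, E (m * c) = -E c) (hχ : χ m = 1) (hκ : κ m = -1)
    (hκP : ∀ c, (κ c : R) - 1 ∈ P) (hG : ∀ c, Gα c = a * E (α * c) - N * E c)
    (hR : ∀ c, (c ∈ Rset ∧ m * c ∉ Rset) ∨ (c ∉ Rset ∧ m * c ∈ Rset)) :
    Ideal.Quotient.mk P (∑ c ∈ Rset, (((χ c)⁻¹ : Rˣ) : R) * Gα c)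
      = Ideal.Quotient.mk P (a * (χ α : R) * (((κ α)⁻¹ : Rˣ) : R) - N)
          * Ideal.Quotient.mk P (∑ c ∈ Rset, (((χ c)⁻¹ : Rˣ) : R) * (κ c : R) * E c) := by
  rw [← map_mul, ← halfResolvent_chi_kappa E Gα χ κ α a N Rset hm hE hχ hκ hG hR, Ideal.Quotient.eq,
    ← sum_sub_distrib]
  refine P.sum_mem fun c _ => ?_
  have h := P.mul_mem_left (-((((χ c)⁻¹ : Rˣ) : R) * Gα c)) (hκP c)
  convert h using 1
  ring

/-- **KB3 core — `κ_χ = red(Λ_e)`.**  Suppose the reduced half-orbit functional of ONE smoothing `α` (closed form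
`Gα = a•E(α·) − N•E`, de Shalit II.3.1 (7)) obeys the coboundary law (A) `red(Σ_{Rset} χ⁻¹ Gα) = κ_χ · red(a χ(α) κ(α)⁻¹ − N)`
with a UNIT factor `red(a χ(α) κ(α)⁻¹ − N)` in `R ⧸ P` (informally `1 + η_e(α) ≠ 0`).  Then, by the level-`0` Kronecker law KB2,
the level-`0` constant is the reduction of the half resolvent: `κ_χ = red(Σ_{Rset} χ⁻¹ κ E)`. [folklore] -/
theorem levelZero_constant_eq_red_halfResolvent (P : Ideal R) (E Gα : G → R) (χ κ : G →* Rˣ) (α : G) (a N : R)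
    (κχ : R ⧸ P) (hm : m * m = 1) (hE : ∀ c, E (m * c) = -E c) (hχ : χ m = 1) (hκ : κ m = -1)
    (hκP : ∀ c, (κ c : R) - 1 ∈ P) (hG : ∀ c, Gα c = a * E (α * c) - N * E c)
    (hR : ∀ c, (c ∈ Rset ∧ m * c ∉ Rset) ∨ (c ∉ Rset ∧ m * c ∈ Rset))
    (hA : Ideal.Quotient.mk P (∑ c ∈ Rset, (((χ c)⁻¹ : Rˣ) : R) * Gα c)
      = κχ * Ideal.Quotient.mk P (a * (χ α : R) * (((κ α)⁻¹ : Rˣ) : R) - N))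
    (hu : IsUnit (Ideal.Quotient.mk P (a * (χ α : R) * (((κ α)⁻¹ : Rˣ) : R) - N))) :
    κχ = Ideal.Quotient.mk P (∑ c ∈ Rset, (((χ c)⁻¹ : Rˣ) : R) * (κ c : R) * E c) := by
  rw [red_halfFunctional_eq P E Gα χ κ α a N hm hE hχ hκ hκP hG hR, mul_comm] at hA
  exact (hu.mul_right_cancel hA).symm

/-- **The level-`0` bit is the unit-ness of `Λ_e`**: with `κ_χ = red(Λ_e)`, `κ_χ = 0 ⟺ Λ_e ∈ P`. [folklore] -/
theorem levelZero_constant_eq_zero_iff (P : Ideal R) {κχ : R ⧸ P} {Λ : R} (h : κχ = Ideal.Quotient.mk P Λ) :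
    κχ = 0 ↔ Λ ∈ P := by
  rw [h, Ideal.Quotient.eq_zero_iff_mem]

end Identification

/-! ## Integrality from one good smoothing -/

section Integrality

variable {K : Type*} [CommRing K]

/-- If `s ∈ O` is a unit OF `O` and `s * Λ ∈ O` then `Λ ∈ O` (for a subring `O ⊆ K`, e.g. a valuation ring). [folklore] -/
theorem mem_subring_of_isUnit_mul_mem (O : Subring K) {s Λ : K} (hs : s ∈ O) (hu : IsUnit (⟨s, hs⟩ : O))
    (h : s * Λ ∈ O) : Λ ∈ O := by
  obtain ⟨u, hu⟩ := hu
  have hvs : ((u⁻¹ : Oˣ) : O).val * s = 1 := by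
    have h1 : (((u⁻¹ : Oˣ) : O) * (u : O) : O).val = (1 : O).val := by rw [u.inv_mul]
    rwa [hu, Subring.coe_mul, Subring.coe_one] at h1
  have hΛ : Λ = ((u⁻¹ : Oˣ) : O).val * (s * Λ) := by rw [← mul_assoc, hvs, one_mul]
  rw [hΛ]
  exact O.mul_mem ((u⁻¹ : Oˣ) : O).prop h

variable {G : Type*} [CommGroup G] [DecidableEq G] {m : G} {Rset : Finset G}

/-- **Integrality of the half resolvent from ONE good smoothing** (card: «choosing `α` with `η_e(α) ≠ 1` gives integrality of
`Λ_e`»): if the twisted half-orbit functional `Σ_{Rset} χ⁻¹κ Gα` lies in a subring `O` (integral values `Gα(P_c)`, root-of-unity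
weights) and the smoothing factor `a χ(α) κ(α)⁻¹ − N` is a unit of `O`, then `Λ_e = Σ_{Rset} χ⁻¹ κ E ∈ O`. [folklore] -/
theorem halfResolvent_mem_subring (O : Subring K) (E Gα : G → K) (χ κ : G →* Kˣ) (α : G) (a N : K)
    (hm : m * m = 1) (hE : ∀ c, E (m * c) = -E c) (hχ : χ m = 1) (hκ : κ m = -1)
    (hG : ∀ c, Gα c = a * E (α * c) - N * E c)
    (hR : ∀ c, (c ∈ Rset ∧ m * c ∉ Rset) ∨ (c ∉ Rset ∧ m * c ∈ Rset))
    (hint : (∑ c ∈ Rset, (((χ c)⁻¹ : Kˣ) : K) * (κ c : K) * Gα c) ∈ O)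
    (hs : a * (χ α : K) * (((κ α)⁻¹ : Kˣ) : K) - N ∈ O)
    (hu : IsUnit (⟨a * (χ α : K) * (((κ α)⁻¹ : Kˣ) : K) - N, hs⟩ : O)) :
    (∑ c ∈ Rset, (((χ c)⁻¹ : Kˣ) : K) * (κ c : K) * E c) ∈ O := by
  refine mem_subring_of_isUnit_mul_mem O hs hu ?_
  rw [← halfResolvent_chi_kappa E Gα χ κ α a N Rset hm hE hχ hκ hG hR]
  exact hint

end Integrality

/-! ## Rung R0 bookkeeping -/

section RungZero

variable {R : Type*} [CommRing R]

/-- `Λ ∉ Q₁ ∨ Λ ∉ Q₂ ⟺ π ∤ Λ` when `Q₁ ⊓ Q₂ = (π)` (informally `𝔔₁𝔔₂ = (1 − ζ_{2^k})` in `F₀ = K(ζ_{3·2^k})`). [folklore] -/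
theorem notMem_or_notMem_iff_not_dvd {Q₁ Q₂ : Ideal R} {π : R} (hQ : Q₁ ⊓ Q₂ = Ideal.span {π}) (Λ : R) :
    (Λ ∉ Q₁ ∨ Λ ∉ Q₂) ↔ ¬ π ∣ Λ := by
  rw [← not_and_or, ← Ideal.mem_span_singleton, ← hQ, Ideal.mem_inf]

variable {G : Type*} [CommGroup G] [DecidableEq G] {m : G} {Rset : Finset G}

/-- **Rung R0 under T0**: with the mirror `σ` of `halfResolvent_mirror` and `Q ⊓ σ⁻¹Q = (π)`, the class is live at level `0`
for SOME twist — `Λ_e ∉ Q` or `Λ_{−e} ∉ Q` — iff `π ∤ Λ_e`. [folklore] -/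
theorem levelZero_live_iff_not_dvd (σ : R →+* R) (E : G → R) (χ κ : G →* Rˣ) (t : G) (Q : Ideal R) (π : R)
    (hσE : ∀ c, σ (E c) = E (t * c)) (hσχ : ∀ c, σ (χ c : R) = (((χ c)⁻¹ : Rˣ) : R)) (hσκ : ∀ c, σ (κ c : R) = (κ c : R))
    (hm : m * m = 1) (hE : ∀ c, E (m * c) = -E c) (hχ : χ m = 1) (hκ : κ m = -1)
    (hR : ∀ c, (c ∈ Rset ∧ m * c ∉ Rset) ∨ (c ∉ Rset ∧ m * c ∈ Rset))
    (hQ : Q ⊓ Q.comap σ = Ideal.span {π}) :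
    ((∑ c ∈ Rset, (((χ c)⁻¹ : Rˣ) : R) * (κ c : R) * E c) ∉ Q
        ∨ (∑ c ∈ Rset, (χ c : R) * (κ c : R) * E c) ∉ Q)
      ↔ ¬ π ∣ ∑ c ∈ Rset, (((χ c)⁻¹ : Rˣ) : R) * (κ c : R) * E c := by
  rw [← halfResolvent_mem_comap_iff σ E χ κ t Q hσE hσχ hσκ hm hE hχ hκ hR]
  exact notMem_or_notMem_iff_not_dvd hQ _

end RungZero

end Summit.BirchSwinnertonDyer.BirchSwinnertonDyer.Theorems.SignedMuAtTwo.KroneckerBits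

/-! ## Appendix A — Galois equivariance of half resolvents (general `σ : R →+* R'`; bits are constant on Galois orbits) -/

namespace Summit.BirchSwinnertonDyer.BirchSwinnertonDyer.Theorems.SignedMuAtTwo.KroneckerBits

section Equivariance

variable {G R R' : Type*} [CommGroup G] [CommRing R] [CommRing R'] {m : G} {Rset : Finset G}

/-- **Galois equivariance of the half resolvent** (general form of `halfResolvent_mirror`; card (T0a) and «for composite `𝔣₀` the
bits are constant on `Aut(ℂ)`-orbits of `(χ₀, 𝔓)` by reciprocity»).  Let `σ : R →+* R'` transport the data: `σ(E c) = E'(t c)` for a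
fixed translation `t`, `σ ∘ χ = χ'`, `σ ∘ κ = κ'`, with `E'` odd, `χ'` even, `κ'` odd.  Then for any representatives modulo `⟨m⟩`:
`σ(Σ_{Rset} χ(c)⁻¹ κ(c) E(c)) = χ'(t) κ'(t)⁻¹ · Σ_{Rset} χ'(c)⁻¹ κ'(c) E'(c)`. [folklore] -/
theorem halfResolvent_map [DecidableEq G] (σ : R →+* R') (E : G → R) (E' : G → R') (χ κ : G →* Rˣ) (χ' κ' : G →* R'ˣ)
    (t : G) (hσE : ∀ c, σ (E c) = E' (t * c)) (hσχ : ∀ c, σ (χ c : R) = (χ' c : R'))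
    (hσκ : ∀ c, σ (κ c : R) = (κ' c : R')) (hm : m * m = 1) (hE' : ∀ c, E' (m * c) = -E' c) (hχ' : χ' m = 1)
    (hκ' : κ' m = -1) (hR : ∀ c, (c ∈ Rset ∧ m * c ∉ Rset) ∨ (c ∉ Rset ∧ m * c ∈ Rset)) :
    σ (∑ c ∈ Rset, (((χ c)⁻¹ : Rˣ) : R) * (κ c : R) * E c)
      = ((χ' t : R') * (((κ' t)⁻¹ : R'ˣ) : R')) * ∑ c ∈ Rset, (((χ' c)⁻¹ : R'ˣ) : R') * (κ' c : R') * E' c := by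
  rw [map_sum]
  have hterm : ∀ c, σ ((((χ c)⁻¹ : Rˣ) : R) * (κ c : R) * E c)
      = (((χ' c)⁻¹ : R'ˣ) : R') * (κ' c : R') * E' (t * c) := by
    intro c
    rw [map_mul, map_mul, map_inv_char_of_map_char_eq σ χ χ' hσχ, hσκ, hσE]
  simp only [hterm]
  exact halfSum_reindex_weight E' (fun c => (((χ' c)⁻¹ : R'ˣ) : R') * (κ' c : R')) t _ (chi_kappa_weight χ' κ' t)
    (chi_kappa_mul_invariant E' χ' κ' hE' hχ' hκ') hm hR

/-- **Bits are constant along `σ`**: under the hypotheses of `halfResolvent_map`, for every ideal `Q` of `R'`,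
`Λ(χ, κ; E) ∈ σ⁻¹ Q ⟺ Λ(χ', κ'; E') ∈ Q`. [folklore] -/
theorem halfResolvent_map_mem_comap_iff [DecidableEq G] (σ : R →+* R') (E : G → R) (E' : G → R') (χ κ : G →* Rˣ)
    (χ' κ' : G →* R'ˣ) (t : G) (Q : Ideal R') (hσE : ∀ c, σ (E c) = E' (t * c))
    (hσχ : ∀ c, σ (χ c : R) = (χ' c : R')) (hσκ : ∀ c, σ (κ c : R) = (κ' c : R')) (hm : m * m = 1)
    (hE' : ∀ c, E' (m * c) = -E' c) (hχ' : χ' m = 1) (hκ' : κ' m = -1)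
    (hR : ∀ c, (c ∈ Rset ∧ m * c ∉ Rset) ∨ (c ∉ Rset ∧ m * c ∈ Rset)) :
    (∑ c ∈ Rset, (((χ c)⁻¹ : Rˣ) : R) * (κ c : R) * E c) ∈ Q.comap σ
      ↔ (∑ c ∈ Rset, (((χ' c)⁻¹ : R'ˣ) : R') * (κ' c : R') * E' c) ∈ Q := by
  rw [Ideal.mem_comap, halfResolvent_map σ E E' χ κ χ' κ' t hσE hσχ hσκ hm hE' hχ' hκ' hR, ← Units.val_mul]
  exact Ideal.unit_mul_mem_iff_mem Q (χ' t * (κ' t)⁻¹).isUnit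

end Equivariance

/-! ## Appendix B — T0 re-proves the coboundary law (A) with the constant named -/

section CoboundaryForm

variable {G R M : Type*} [CommGroup G] [DecidableEq G] [CommRing R] [CommMonoid M] {m : G} {Rset : Finset G}

/-- **T0 ⟹ law (A) with `κ_χ = red(Λ_e)`.**  For a family of smoothings indexed by a commutative monoid `M` (informally the odd
elements of `𝒪_K` prime to `𝔣₀`: `x ↦ α = αof x`, `a x = α`, `N x = Nα`) with closed forms `G_x = a(x)•E(αof x ·) − N(x)•E` and a
multiplier `η : M →* R ⧸ P` with `red(a(x) χ(αof x) κ(αof x)⁻¹ − N(x)) = η(x) − 1` (informally `α ε(α) − Nα ≡ 1 + η_e(α)` in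
characteristic `2`), the reduced half-orbit functional is the COBOUNDARY `f(x) = red(Λ_e) · (η(x) − 1)`. [folklore] -/
theorem red_halfFunctional_eq_coboundary (P : Ideal R) (E : G → R) (Gf : M → G → R) (χ κ : G →* Rˣ) (αof : M → G)
    (a N : M → R) (η : M →* R ⧸ P) (hm : m * m = 1) (hE : ∀ c, E (m * c) = -E c) (hχ : χ m = 1) (hκ : κ m = -1)
    (hκP : ∀ c, (κ c : R) - 1 ∈ P) (hG : ∀ x c, Gf x c = a x * E (αof x * c) - N x * E c)
    (hR : ∀ c, (c ∈ Rset ∧ m * c ∉ Rset) ∨ (c ∉ Rset ∧ m * c ∈ Rset))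
    (hη : ∀ x, Ideal.Quotient.mk P (a x * (χ (αof x) : R) * (((κ (αof x))⁻¹ : Rˣ) : R) - N x) = η x - 1) (x : M) :
    Ideal.Quotient.mk P (∑ c ∈ Rset, (((χ c)⁻¹ : Rˣ) : R) * Gf x c)
      = Ideal.Quotient.mk P (∑ c ∈ Rset, (((χ c)⁻¹ : Rˣ) : R) * (κ c : R) * E c) * (η x - 1) := by
  rw [red_halfFunctional_eq P E (Gf x) χ κ (αof x) (a x) (N x) hm hE hχ hκ hκP (hG x) hR, hη, mul_comm]

/-- Consequently the reduced half-orbit functional is a TWISTED COCYCLE `f(x y) = f(y) + η(y) f(x)` of the monoid of smoothings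
(the scalar law CS2 of `smoothing-coboundary`, here DERIVED from T0 rather than assumed). [folklore] -/
theorem red_halfFunctional_cocycle (P : Ideal R) (E : G → R) (Gf : M → G → R) (χ κ : G →* Rˣ) (αof : M → G)
    (a N : M → R) (η : M →* R ⧸ P) (hm : m * m = 1) (hE : ∀ c, E (m * c) = -E c) (hχ : χ m = 1) (hκ : κ m = -1)
    (hκP : ∀ c, (κ c : R) - 1 ∈ P) (hG : ∀ x c, Gf x c = a x * E (αof x * c) - N x * E c)
    (hR : ∀ c, (c ∈ Rset ∧ m * c ∉ Rset) ∨ (c ∉ Rset ∧ m * c ∈ Rset))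
    (hη : ∀ x, Ideal.Quotient.mk P (a x * (χ (αof x) : R) * (((κ (αof x))⁻¹ : Rˣ) : R) - N x) = η x - 1) (x y : M) :
    Ideal.Quotient.mk P (∑ c ∈ Rset, (((χ c)⁻¹ : Rˣ) : R) * Gf (x * y) c)
      = Ideal.Quotient.mk P (∑ c ∈ Rset, (((χ c)⁻¹ : Rˣ) : R) * Gf y c)
        + η y * Ideal.Quotient.mk P (∑ c ∈ Rset, (((χ c)⁻¹ : Rˣ) : R) * Gf x c) := by
  rw [red_halfFunctional_eq_coboundary P E Gf χ κ αof a N η hm hE hχ hκ hκP hG hR hη (x * y),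
    red_halfFunctional_eq_coboundary P E Gf χ κ αof a N η hm hE hχ hκ hκP hG hR hη x,
    red_halfFunctional_eq_coboundary P E Gf χ κ αof a N η hm hE hχ hκ hκP hG hR hη y, map_mul]
  ring

end CoboundaryForm

end Summit.BirchSwinnertonDyer.BirchSwinnertonDyer.Theorems.SignedMuAtTwo.KroneckerBits

/-! ## Appendix C — the level-`0` bit does not depend on the auxiliary `κ`; the twist-free product criterion (card, falsifier (b)) -/

namespace Summit.BirchSwinnertonDyer.BirchSwinnertonDyer.Theorems.SignedMuAtTwo.KroneckerBits

section KappaFree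

variable {G R : Type*} [CommGroup G] [DecidableEq G] [CommRing R] {m : G} {Rset : Finset G}

/-- **`red(Λ_e)` does not depend on the auxiliary odd character `κ`** (card: «the level-0 bit … independent of κ»): for two odd
characters `κ, κ' ≡ 1 (mod P)` and one smoothing `α` whose reduced factor `red(a χ(α) − N)` is a unit of `R ⧸ P`,
`red(Σ_{Rset} χ⁻¹ κ E) = red(Σ_{Rset} χ⁻¹ κ' E)`. [folklore] -/
theorem red_halfResolvent_eq_of_congr_one (P : Ideal R) (E Gα : G → R) (χ κ κ' : G →* Rˣ) (α : G) (a N : R)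
    (hm : m * m = 1) (hE : ∀ c, E (m * c) = -E c) (hχ : χ m = 1) (hκ : κ m = -1) (hκ' : κ' m = -1)
    (hκP : ∀ c, (κ c : R) - 1 ∈ P) (hκ'P : ∀ c, (κ' c : R) - 1 ∈ P) (hG : ∀ c, Gα c = a * E (α * c) - N * E c)
    (hR : ∀ c, (c ∈ Rset ∧ m * c ∉ Rset) ∨ (c ∉ Rset ∧ m * c ∈ Rset))
    (hu : IsUnit (Ideal.Quotient.mk P (a * (χ α : R) - N))) :
    Ideal.Quotient.mk P (∑ c ∈ Rset, (((χ c)⁻¹ : Rˣ) : R) * (κ c : R) * E c)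
      = Ideal.Quotient.mk P (∑ c ∈ Rset, (((χ c)⁻¹ : Rˣ) : R) * (κ' c : R) * E c) := by
  -- the reduced smoothing factor does not see κ: red(a χ(α) κ(α)⁻¹ − N) = red(a χ(α) − N)
  have hfac : ∀ (μ : G →* Rˣ), (∀ c, (μ c : R) - 1 ∈ P) →
      Ideal.Quotient.mk P (a * (χ α : R) * (((μ α)⁻¹ : Rˣ) : R) - N) = Ideal.Quotient.mk P (a * (χ α : R) - N) := by
    intro μ hμ
    rw [Ideal.Quotient.eq]
    have h1 : (((μ α)⁻¹ : Rˣ) : R) * (μ α : R) = 1 := Units.inv_mul _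
    have h := P.mul_mem_left (-(a * (χ α : R) * (((μ α)⁻¹ : Rˣ) : R))) (hμ α)
    convert h using 1
    linear_combination (a * (χ α : R)) * h1
  have h1 := red_halfFunctional_eq P E Gα χ κ α a N hm hE hχ hκ hκP hG hR
  have h2 := red_halfFunctional_eq P E Gα χ κ' α a N hm hE hχ hκ' hκ'P hG hR
  rw [hfac κ hκP] at h1
  rw [hfac κ' hκ'P, h1] at h2
  exact hu.mul_left_cancel h2

end KappaFree

section TwistFreeProduct

variable {G R : Type*} [CommGroup G] [DecidableEq G] [CommRing R] {m : G} {Rset : Finset G}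

/-- The mirror applied to the mirror: under the hypotheses of `halfResolvent_mirror`, `σ(Λ_{−e}) = χ(t) κ(t)⁻¹ · Λ_e`. [folklore] -/
theorem halfResolvent_mirror' (σ : R →+* R) (E : G → R) (χ κ : G →* Rˣ) (t : G)
    (hσE : ∀ c, σ (E c) = E (t * c)) (hσχ : ∀ c, σ (χ c : R) = (((χ c)⁻¹ : Rˣ) : R)) (hσκ : ∀ c, σ (κ c : R) = (κ c : R))
    (hm : m * m = 1) (hE : ∀ c, E (m * c) = -E c) (hχ : χ m = 1) (hκ : κ m = -1)
    (hR : ∀ c, (c ∈ Rset ∧ m * c ∉ Rset) ∨ (c ∉ Rset ∧ m * c ∈ Rset)) :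
    σ (∑ c ∈ Rset, (χ c : R) * (κ c : R) * E c)
      = ((χ t : R) * (((κ t)⁻¹ : Rˣ) : R)) * ∑ c ∈ Rset, (((χ c)⁻¹ : Rˣ) : R) * (κ c : R) * E c := by
  have hσχ' : ∀ c, σ ((χ⁻¹ : G →* Rˣ) c : R) = (χ c : R) := fun c => by
    rw [MonoidHom.inv_apply, map_inv_char_of_map_char_eq_inv σ χ χ hσχ]
  have h := halfResolvent_map σ E E (χ⁻¹) κ χ κ t hσE hσχ' hσκ hm hE hχ hκ hR
  simpa only [MonoidHom.inv_apply, inv_inv] using h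

/-- **Twist-free product criterion** (card, cheapest falsifier (b): «`P := Λ₁·S(χ₀²κ)` is a unit at BOTH primes over 2 ⟺ the pattern is
`{1,1}`»): for a PRIME `Q` and the mirror `σ`, `Λ_e · Λ_{−e} ∉ Q ⟺ (Λ_e ∉ Q ∧ Λ_e ∉ σ⁻¹Q)` — the product tests both bits of ONE twist,
labelling-free. [folklore] -/
theorem twistFree_product_not_mem_iff (σ : R →+* R) (E : G → R) (χ κ : G →* Rˣ) (t : G) (Q : Ideal R) [Q.IsPrime]
    (hσE : ∀ c, σ (E c) = E (t * c)) (hσχ : ∀ c, σ (χ c : R) = (((χ c)⁻¹ : Rˣ) : R)) (hσκ : ∀ c, σ (κ c : R) = (κ c : R))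
    (hm : m * m = 1) (hE : ∀ c, E (m * c) = -E c) (hχ : χ m = 1) (hκ : κ m = -1)
    (hR : ∀ c, (c ∈ Rset ∧ m * c ∉ Rset) ∨ (c ∉ Rset ∧ m * c ∈ Rset)) :
    (∑ c ∈ Rset, (((χ c)⁻¹ : Rˣ) : R) * (κ c : R) * E c) * (∑ c ∈ Rset, (χ c : R) * (κ c : R) * E c) ∉ Q
      ↔ ((∑ c ∈ Rset, (((χ c)⁻¹ : Rˣ) : R) * (κ c : R) * E c) ∉ Q
          ∧ (∑ c ∈ Rset, (((χ c)⁻¹ : Rˣ) : R) * (κ c : R) * E c) ∉ Q.comap σ) := by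
  rw [Ideal.IsPrime.mul_mem_iff_mem_or_mem ‹Q.IsPrime›, not_or,
    halfResolvent_mem_comap_iff σ E χ κ t Q hσE hσχ hσκ hm hE hχ hκ hR]

/-- The same product read at the mirror prime: `Λ_e · Λ_{−e} ∉ σ⁻¹Q ⟺ (Λ_e ∉ Q ∧ Λ_e ∉ σ⁻¹Q)` as well — so «unit at both primes»
and «unit at one prime» coincide for the twist-free product, and both say: pattern `(1,1)`. [folklore] -/
theorem twistFree_product_not_mem_comap_iff (σ : R →+* R) (E : G → R) (χ κ : G →* Rˣ) (t : G) (Q : Ideal R) [Q.IsPrime]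
    (hσE : ∀ c, σ (E c) = E (t * c)) (hσχ : ∀ c, σ (χ c : R) = (((χ c)⁻¹ : Rˣ) : R)) (hσκ : ∀ c, σ (κ c : R) = (κ c : R))
    (hm : m * m = 1) (hE : ∀ c, E (m * c) = -E c) (hχ : χ m = 1) (hκ : κ m = -1)
    (hR : ∀ c, (c ∈ Rset ∧ m * c ∉ Rset) ∨ (c ∉ Rset ∧ m * c ∈ Rset)) :
    (∑ c ∈ Rset, (((χ c)⁻¹ : Rˣ) : R) * (κ c : R) * E c) * (∑ c ∈ Rset, (χ c : R) * (κ c : R) * E c) ∉ Q.comap σ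
      ↔ ((∑ c ∈ Rset, (((χ c)⁻¹ : Rˣ) : R) * (κ c : R) * E c) ∉ Q
          ∧ (∑ c ∈ Rset, (((χ c)⁻¹ : Rˣ) : R) * (κ c : R) * E c) ∉ Q.comap σ) := by
  have hmir : (∑ c ∈ Rset, (χ c : R) * (κ c : R) * E c) ∈ Q.comap σ
      ↔ (∑ c ∈ Rset, (((χ c)⁻¹ : Rˣ) : R) * (κ c : R) * E c) ∈ Q := by
    rw [Ideal.mem_comap, halfResolvent_mirror' σ E χ κ t hσE hσχ hσκ hm hE hχ hκ hR, ← Units.val_mul]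
    exact Ideal.unit_mul_mem_iff_mem Q (χ t * (κ t)⁻¹).isUnit
  rw [Ideal.IsPrime.mul_mem_iff_mem_or_mem (inferInstance : (Q.comap σ).IsPrime), not_or, hmir, and_comm]

end TwistFreeProduct

end Summit.BirchSwinnertonDyer.BirchSwinnertonDyer.Theorems.SignedMuAtTwo.KroneckerBits
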